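import Summits.SmoothPoincare4.SmoothPoincare4.Theses.CylinderEntropy
import Summits.SmoothPoincare4.SmoothPoincare4.Theorems.CylinderEntropyCylinderRungTwoGraphicalIsSphere
import Summits.SmoothPoincare4.SmoothPoincare4.Theorems.CylinderEntropyCylinderRungTwoOneSheet
import Summits.SmoothPoincare4.SmoothPoincare4.Theorems.CylinderEntropyCylinderRungTwoKillingFluxDefs
import Summits.SmoothPoincare4.SmoothPoincare4.Theorems.CylinderEntropyCylinderRungTwoHamiltonMonotonicity
import Summits.SmoothPoincare4.SmoothPoincare4.Theorems.CylinderEntropyCylinderRungTwoRelaxationOfAreaToFloor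
import Summits.SmoothPoincare4.SmoothPoincare4.Theorems.CylinderEntropyCylinderRungTwoTiltGap
import Summits.SmoothPoincare4.SmoothPoincare4.Theorems.CylinderEntropyCylinderRungTwoDissipationBudget
import Summits.SmoothPoincare4.SmoothPoincare4.Theorems.CylinderEntropyCylinderRungTwoAreaToFloorOfQuantization
import Summits.SmoothPoincare4.SmoothPoincare4.Theorems.CylinderEntropyCylinderRungTwoWhiteSheetOfFact
import Summits.SmoothPoincare4.SmoothPoincare4.Theorems.CylinderEntropyCylinderRungTwoEpsilonRegularityOfWhite
import Summits.SmoothPoincare4.SmoothPoincare4.Theorems.CylinderEntropyCylinderRungTwoAreaQuantizationOfAllard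
import Summits.SmoothPoincare4.SmoothPoincare4.Theorems.CylinderEntropyRungTwoOfSliceIsolationReduction
import Literature.Geometry.Riemannian.WhiteLocalRegularityCylinderFlow
import Literature.Geometry.GeometricMeasureTheory.AllardIntegralDensityOfLimits
import Literature.Geometry.Riemannian.SphericalCylinderEntropy
import Literature.Topology.FourManifolds.HomotopyS4CompactProofs
import HarnessLib

/-!
# Route `CylinderEntropy`, crux `CylinderRungTwo` (stmt-SmoothPoincare4-7631), line `killing-flux`:
# the REDUCTION — the crux from the finite-time half and two published named facts

This is the sorry-free composition of the checked skeleton `Cruxes/CylinderRungTwo/Lines/killing_flux.lean`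
(lead reshapes r1–r11), moved into `Theorems/` so that the tree itself carries it (registered helpers
`helper_cylinderRungTwoOfNamedFacts`, `helper_cylinderRungTwoOfAllardAndIsolation`; lead c3).

* **Path A.** `CylinderRungTwo` follows from
  (1) the FINITE-TIME HALF (the crux-equivalent open step: every thin homotopy-4-sphere cross-section of
      `N = S⁴ × ℝ` carries an immortal smooth thin cylinder flow OF `M` in its slab — spelled out over the
      landed vocabulary `IsCylinderMCF`, exactly the registered stub `stub_finiteTimeHalf`; its converse
      `CylinderRungTwo → FiniteTimeHalf` is the tree theorem `helper_finiteTimeHalfOfCylinderRungTwo`),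
  (2) Allard's integrality of limits
      (`Literature.Geometry.GeometricMeasureTheory.Allard1972_integralDensityOfLimits_cylinderCrossSections`,
      named fact, statement only) and
  (3) White's local regularity theorem for cylinder flows
      (`Literature.Geometry.Riemannian.White2005_localRegularity_cylinderFlowSheet`, named fact),
  through the LANDED chain: Hamilton monotonicity (`stub_hamiltonMonotonicity`) + dissipation budget
  (`stub_dissipationBudget`) + area quantization from Allard (`helper_areaQuantizationOfAllard`) + area to
  the floor (`helper_areaToFloorOfQuantization`) + relaxation (`stub_relaxationOfAreaToFloor`) give
  `λ_cyl(F t) → 1`; White's theorem (`helper_whiteSheetOfFact`, `helper_epsilonRegularityOfWhite`) + the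
  tilt gap (`stub_tiltGap`, which consumes the landed flux identity) make the unit normal nowhere
  horizontal after one unit of `(1+ε)`-thin flow, so the shadow is an immersion, with one sheet
  (`stub_oneSheet`), and a graphical cross-section is a standard sphere (`stub_graphicalIsSphere`).
* **Path B.** `CylinderRungTwo` follows from (1), (2) and the route's rank-3 crux `SliceIsolation`
  (stmt-SmoothPoincare4-7632) BY NAME, through the landed flow interface of item stmt-SmoothPoincare4-14765
  (`rungTwoOfSliceIsolation_of_flow` with `Flow := IsCylinderMCF`) — no parabolic regularity.

Both theorems are CONDITIONAL on published named facts (the gate records `conditional-result`); no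
definition is introduced here (the finite-time half is written out as a hypothesis), nothing is sorried.
-/

noncomputable section

-- the prescribed namespace `Summit.SmoothPoincare4.SmoothPoincare4.…` repeats `SmoothPoincare4`
set_option linter.dupNamespace false

open MeasureTheory Set
open scoped Manifold ContDiff ENNReal Topology BigOperators ContinuousMap

namespace Summit.SmoothPoincare4.SmoothPoincare4.Cruxes.CylinderRungTwo.KillingFlux

open Literature.Geometry.Riemannian
open Literature.Geometry.Riemannian.SphericalCylinderEntropy (cylEntropy cylDensity truncL)
open Summit.SmoothPoincare4.SmoothPoincare4.Theses.CylinderEntropy (CylinderRungTwo SliceIsolation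
  RungTwoOfSliceIsolation)

/-- A vector of `ℝ⁶` with vanishing truncation and orthogonal to a vector with non-zero last coordinate
vanishes. [folklore] -/
theorem Reduction.eq_zero_of_truncL_eq_zero_of_inner_eq_zero {n w : EuclideanSpace ℝ (Fin 6)}
    (hw : truncL w = 0) (hinner : @inner ℝ _ _ n w = 0) (h5 : n 5 ≠ 0) : w = 0 := by
  have hc : ∀ i : Fin 5, w (Fin.castSucc i) = 0 := fun i => by
    have := congrArg (fun z : EuclideanSpace ℝ (Fin 5) => z i) hw
    simpa using this
  have hsum : @inner ℝ _ _ n w = ∑ j : Fin 6, w j * n j := by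
    rw [PiLp.inner_apply]
    simp [mul_comm]
  rw [hsum, Fin.sum_univ_castSucc] at hinner
  simp only [hc, zero_mul, Finset.sum_const_zero, zero_add] at hinner
  have h5w : w (Fin.last 5) = 0 := (mul_eq_zero.1 hinner).resolve_right h5
  ext j
  obtain ⟨i, rfl⟩ | rfl := Fin.eq_castSucc_or_eq_last j
  · simpa using hc i
  · simpa using h5w

/-- **The shadow of a cross-section is immersive where the normal is not horizontal**: if `dι_x` is
injective, `ν x ⊥ dι_x(T_x M)` and `ν x 5 ≠ 0`, then `d(truncL ∘ ι)_x = truncL ∘ dι_x` is injective.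
[folklore] -/
theorem Reduction.injective_mfderiv_truncL_comp {M : Type} [TopologicalSpace M]
    [ChartedSpace (EuclideanSpace ℝ (Fin 4)) M]
    {ι ν : M → EuclideanSpace ℝ (Fin 6)} {x : M} (hι : MDifferentiableAt (𝓡 4) (𝓡 6) ι x)
    (hinj : Function.Injective (mfderiv (𝓡 4) (𝓡 6) ι x))
    (hν : (euclideanMetric (EuclideanSpace ℝ (Fin 6))).IsNormalTo (𝓡 4) ι ν) (h5 : ν x 5 ≠ 0) :
    Function.Injective (mfderiv (𝓡 4) (𝓡 5)
      ((truncL : EuclideanSpace ℝ (Fin 6) → EuclideanSpace ℝ (Fin 5)) ∘ ι) x) := by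
  have hcomp : mfderiv (𝓡 4) (𝓡 5) ((truncL : EuclideanSpace ℝ (Fin 6) → EuclideanSpace ℝ (Fin 5)) ∘ ι) x =
      (truncL : EuclideanSpace ℝ (Fin 6) →L[ℝ] EuclideanSpace ℝ (Fin 5)).comp (mfderiv (𝓡 4) (𝓡 6) ι x) :=
    ((truncL.hasMFDerivAt (x := ι x)).comp x hι.hasMFDerivAt).mfderiv
  rw [hcomp]
  refine (injective_iff_map_eq_zero _).2 fun v hv => ?_
  have hw : (mfderiv (𝓡 4) (𝓡 6) ι x v : EuclideanSpace ℝ (Fin 6)) = 0 := by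
    refine Reduction.eq_zero_of_truncL_eq_zero_of_inner_eq_zero (n := ν x) hv ?_ h5
    have h := hν x v
    rwa [euclideanMetric_apply] at h
  exact hinj (by rw [hw, map_zero])

/-- **REDUCTION, path A (registered helper `helper_cylinderRungTwoOfNamedFacts`).**  The crux
`CylinderEntropy.CylinderRungTwo` (stmt-SmoothPoincare4-7631) follows from the finite-time half (spelled out:
the registered stub `stub_finiteTimeHalf` of the line's checked skeleton) and the two published named facts
`Allard1972_integralDensityOfLimits_cylinderCrossSections` and `White2005_localRegularity_cylinderFlowSheet`;
every other step is a landed theorem of this line (module docstring).  CONDITIONAL on the two named facts.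
[cite: Allard1972, Thm. 6.4 and 3.5] [cite: White2005, Thm. 3.1 and §4] -/
theorem helper_cylinderRungTwoOfNamedFacts : (∀ (M : Type) [TopologicalSpace M] [T2Space M] [SecondCountableTopology M] [ChartedSpace (EuclideanSpace ℝ (Fin 4)) M] [IsManifold (𝓡 4) ∞ M], M ≃ₕ Metric.sphere (0 : EuclideanSpace ℝ (Fin 5)) 1 → ∀ ι : M → EuclideanSpace ℝ (Fin 6), Manifold.IsSmoothEmbedding (𝓡 4) (𝓡 6) ∞ ι → (∀ x, ∑ i : Fin 5, ι x (Fin.castSucc i) ^ 2 = 1) → SeparatesEnds (Set.range ι) → cylEntropy (Set.range ι) < ENNReal.ofReal (4 / Real.exp 1) → ∃ (F : ℝ → M → EuclideanSpace ℝ (Fin 6)) (ν : ℝ → M → EuclideanSpace ℝ (Fin 6)) (T : ℝ), IsCylinderMCF M F ν T ∧ (∀ t, T ≤ t → SeparatesEnds (Set.range (F t))) ∧ (∀ t, T ≤ t → cylEntropy (Set.range (F t)) < ENNReal.ofReal (4 / Real.exp 1)) ∧ (∀ t, T ≤ t → ∀ x, ∃ y y' : M, ι y 5 - 1 ≤ F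 t x 5 ∧ F t x 5 ≤ ι y' 5 + 1)) → Literature.Geometry.GeometricMeasureTheory.Allard1972_integralDensityOfLimits_cylinderCrossSections → Literature.Geometry.Riemannian.White2005_localRegularity_cylinderFlowSheet → Summit.SmoothPoincare4.SmoothPoincare4.Theses.CylinderEntropy.CylinderRungTwo := by
  intro h₁ hA hW M _ _ _ _ _ e ι hι hN hsep hent
  -- instances from `M ≃ₕ S⁴` (PROVED in the tree)
  haveI : CompactSpace M :=
    Literature.Topology.FourManifolds.compactSpace_of_homotopyEquiv_sphere_four_holds M e
  haveI : PathConnectedSpace M := by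
    haveI := Literature.Topology.FourManifolds.pathConnectedSpace_sphere_four
    exact Literature.Topology.FourManifolds.pathConnectedSpace_of_homotopyEquiv e
  -- RELAXATION (landed chain over the Allard fact): `λ_cyl(F s) < 1 + ε` eventually
  have h₃ := stub_relaxationOfAreaToFloor stub_hamiltonMonotonicity
    (helper_areaToFloorOfQuantization stub_dissipationBudget (helper_areaQuantizationOfAllard hA))
  -- VERTICAL GAP (landed chain over the White fact): the universal `ε` of the graphical regime
  obtain ⟨ε, hε, hgap⟩ :=
    stub_tiltGap (helper_epsilonRegularityOfWhite (helper_whiteSheetOfFact hW))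
  -- the finite-time half: an immortal smooth flow of cross-section embeddings of `M`
  obtain ⟨F, ν, T, hflow, hsepF, hentF, -⟩ := h₁ M e ι hι hN hsep hent
  have h2 : ∀ t, T ≤ t → cylEntropy (Set.range (F t)) < 2 := fun t ht =>
    lt_of_lt_of_le (hentF t ht)
      Summit.SmoothPoincare4.SmoothPoincare4.Theorems.CylinderEntropyRungTwoOfSliceIsolation.ofReal_four_div_exp_one_le_two
  -- relaxation below `1 + ε` from some time `t₀ ≥ T` on
  obtain ⟨t₀, hTt₀, hsmall⟩ := h₃ M F ν T hflow hsepF h2 ε hε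
  -- after one unit of `(1+ε)`-thin flow the normal is nowhere horizontal, so the shadow is an immersion
  have hT1 : T ≤ t₀ + 1 := by linarith
  have himm : ∀ x : M, Function.Injective (mfderiv (𝓡 4) (𝓡 5)
      ((truncL : EuclideanSpace ℝ (Fin 6) → EuclideanSpace ℝ (Fin 5)) ∘ F (t₀ + 1)) x) := by
    intro x
    have hsm : ContMDiff (𝓡 4) (𝓡 6) ∞ (F (t₀ + 1)) := (hflow.isSmoothEmbedding _ hT1).contMDiff
    refine Reduction.injective_mfderiv_truncL_comp ((hsm x).mdifferentiableAt (by simp))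
      ((hflow.isSpacelikeImmersion _ hT1).injective_mfderiv x) (hflow.isUnitNormal _ hT1).1 ?_
    exact hgap M F ν T hflow (t₀ + 1) (by linarith)
      (fun s hs => hsepF s (by linarith [hs.1]))
      (fun s hs => hsmall s (by linarith [hs.1])) x
  -- one sheet, and a graphical cross-section is a standard sphere
  have hinj := Summit.SmoothPoincare4.SmoothPoincare4.Theorems.CylinderRungTwo.KillingFlux.stub_oneSheet
    M (F (t₀ + 1)) (hflow.isSmoothEmbedding _ hT1) (hflow.mem_cyl _ hT1) himm
  exact Summit.SmoothPoincare4.SmoothPoincare4.Theorems.CylinderRungTwo.KillingFlux.stub_graphicalIsSphere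
    M (F (t₀ + 1)) (hflow.isSmoothEmbedding _ hT1) (hflow.mem_cyl _ hT1) ⟨hinj, himm⟩

/-- **REDUCTION, path B (registered helper `helper_cylinderRungTwoOfAllardAndIsolation`).**  The crux
`CylinderEntropy.CylinderRungTwo` follows from the finite-time half (spelled out), Allard's named fact and
the route's rank-3 crux `CylinderEntropy.SliceIsolation` (stmt-SmoothPoincare4-7632) BY NAME — through item
stmt-SmoothPoincare4-14765's landed flow interface `rungTwoOfSliceIsolation_of_flow` with
`Flow := IsCylinderMCF` and the landed relaxation chain; no White regularity, no flux identity, no graph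
argument.  CONDITIONAL on the Allard fact. [cite: Allard1972, Thm. 6.4 and 3.5] -/
theorem helper_cylinderRungTwoOfAllardAndIsolation : (∀ (M : Type) [TopologicalSpace M] [T2Space M] [SecondCountableTopology M] [ChartedSpace (EuclideanSpace ℝ (Fin 4)) M] [IsManifold (𝓡 4) ∞ M], M ≃ₕ Metric.sphere (0 : EuclideanSpace ℝ (Fin 5)) 1 → ∀ ι : M → EuclideanSpace ℝ (Fin 6), Manifold.IsSmoothEmbedding (𝓡 4) (𝓡 6) ∞ ι → (∀ x, ∑ i : Fin 5, ι x (Fin.castSucc i) ^ 2 = 1) → SeparatesEnds (Set.range ι) → cylEntropy (Set.range ι) < ENNReal.ofReal (4 / Real.exp 1) → ∃ (F : ℝ → M → EuclideanSpace ℝ (Fin 6)) (ν : ℝ → M → EuclideanSpace ℝ (Fin 6)) (T : ℝ), IsCylinderMCF M F ν T ∧ (∀ t, T ≤ t → SeparatesEnds (Set.range (F t))) ∧ (∀ t, T ≤ t → cylEntropy (Set.range (F t)) < ENNReal.ofReal (4 / Real.exp 1)) ∧ (∀ t, T ≤ t → ∀ x, ∃ y y' : M, ι y 5 - 1 ≤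 F t x 5 ∧ F t x 5 ≤ ι y' 5 + 1)) → Literature.Geometry.GeometricMeasureTheory.Allard1972_integralDensityOfLimits_cylinderCrossSections → Summit.SmoothPoincare4.SmoothPoincare4.Theses.CylinderEntropy.SliceIsolation → Summit.SmoothPoincare4.SmoothPoincare4.Theses.CylinderEntropy.CylinderRungTwo := by
  intro h₁ hA hI
  have h₃ := stub_relaxationOfAreaToFloor stub_hamiltonMonotonicity
    (helper_areaToFloorOfQuantization stub_dissipationBudget (helper_areaQuantizationOfAllard hA))
  have h14765 : RungTwoOfSliceIsolation :=
    Summit.SmoothPoincare4.SmoothPoincare4.Theorems.CylinderEntropyRungTwoOfSliceIsolation.rungTwoOfSliceIsolation_of_flow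
      (fun M _ _ _ F ν T => IsCylinderMCF M F ν T)
      (fun M _ _ _ F ν T (hflow : IsCylinderMCF M F ν T) t ht => hflow.isSmoothEmbedding t ht)
      (fun M _ _ _ F ν T (hflow : IsCylinderMCF M F ν T) t ht x => hflow.mem_cyl t ht x)
      (fun M _ _ _ _ _ e ι hι hN hsep hent => by
        obtain ⟨F, ν, T, hflow, hsepF, hentF, -⟩ := h₁ M e ι hι hN hsep hent
        exact ⟨F, ν, T, hflow, hsepF, hentF⟩)
      (fun M _ _ _ _ _ _ _ F ν T hflow hsep hent => h₃ M F ν T hflow hsep hent)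
  exact h14765 hI

end Summit.SmoothPoincare4.SmoothPoincare4.Cruxes.CylinderRungTwo.KillingFlux

end
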